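import Summits.CriticalPhenomena.PercolationContinuityZ3.Theorems.Transplant.CayleyHantzscheWendtGroup
import HarnessLib

/-!
# The Hantzsche–Wendt group, II: the PARITY INVARIANT of its elements (the four cosets of `2ℤ³`), the fibre of the cocycle chart over the base
# value (vertical translations only), and `Hom(HW, ℤ) = 0` — the first Betti number of `P2₁2₁2₁` is ZERO

builds on p205010 (kernel theorem, internal audit signed; external expert review pending) — nothing in this file uses p205010; pure group theory.
Lane `prim-bschramm`, seat `prim-bschramm-p4` (gen 20; PART C3, `HOME/bschramm/P4-GENERAL.md` §42).  Helper file
(`--supports stmt-CriticalPhenomena-4575 --as helper`); consumed by `CayleyHantzscheWendt`.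
* §5 `goodSet` (`D₀D₁D₂ = 1`, `v₀ ≡ δ(D₁)`, `v₁ ≡ δ(D₂)`, `v₂ ≡ δ(D₀)` mod 2): holds on the generators, is multiplicative and inversion-stable, hence holds on
  `HW` (`good_of_mem`); **`eq_vertical`: an element of `HW` with `chart = 0` is a vertical translation `((0,0,2m), 1)`** (used for the cylinder
  connectivity (κ) of the Cayley graph);
* §6 **`hom_int_trivial : every homomorphism HW → ℤ is trivial`** (`χ(α) = 0` from `βα²β⁻¹ = α⁻²`, `χ(β) = 0` from `αβ²α⁻¹ = β⁻²`): `HW` has no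
  rank-two homomorphism to `ℤ²`, so its Cayley graphs lie outside EVERY additive row of the class map (`CayleySign₂`, `CayleyScaled`, `AutScaled`
  applied to `HW` itself).
[cite: ConwaySloane1999, Ch. 4 §6.1 (the diamond packing as a union of two cosets)] [cite: BenjaminiSchramm1996, §2 (Cayley graphs)]
-/

noncomputable section

namespace Summit.CriticalPhenomena.PercolationContinuityZ3.Theorems.Transplant

open Literature.Probability.LatticeModels
open scoped Classical

namespace HW

/-! ## §5 The parity invariant of `HW` and the fibre over the base value -/

/-- **Parity invariant** (as a set): `D₀D₁D₂ = 1` and `v₀ ≡ δ(D₁)`, `v₁ ≡ δ(D₂)`, `v₂ ≡ δ(D₀)` mod 2 — the four cosets of `2ℤ³` making up `HW`.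
[cite: ConwaySloane1999, Ch. 4 §6.1 (two cosets)] -/
def goodSet : Set P :=
  {g | (g.right 0 : ℤ) * (g.right 1 : ℤ) * (g.right 2 : ℤ) = 1 ∧ (2 : ℤ) ∣ tr g 0 - δ (g.right 1) ∧
    (2 : ℤ) ∣ tr g 1 - δ (g.right 2) ∧ (2 : ℤ) ∣ tr g 2 - δ (g.right 0)}

/-- The generators satisfy the invariant. [folklore] -/
theorem good_gens {s : P} (hs : s ∈ gens) : s ∈ goodSet := by
  simp only [gens, Set.mem_insert_iff, Set.mem_singleton_iff] at hs
  rcases hs with rfl | rfl | rfl | rfl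
  · simp only [goodSet, Set.mem_setOf_eq]; decide
  · rw [α, mk_inv]; simp only [goodSet, Set.mem_setOf_eq]; decide
  · simp only [goodSet, Set.mem_setOf_eq]; decide
  · rw [β, mk_inv]; simp only [goodSet, Set.mem_setOf_eq]; decide

/-- The invariant is multiplicative. [folklore] -/
theorem good_mul {g h : P} (hg : g ∈ goodSet) (hh : h ∈ goodSet) : g * h ∈ goodSet := by
  obtain ⟨hg0, hg1, hg2, hg3⟩ := hg
  obtain ⟨hh0, hh1, hh2, hh3⟩ := hh
  simp only [goodSet, Set.mem_setOf_eq, tr_mul, right_mul, Pi.add_apply, Pi.mul_apply, sgnAut_apply, Units.val_mul]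
  refine ⟨?_, ?_, ?_, ?_⟩ <;>
    rcases Int.units_eq_one_or (g.right 0) with a0 | a0 <;> rcases Int.units_eq_one_or (g.right 1) with a1 | a1 <;>
    rcases Int.units_eq_one_or (g.right 2) with a2 | a2 <;> rcases Int.units_eq_one_or (h.right 0) with b0 | b0 <;>
    rcases Int.units_eq_one_or (h.right 1) with b1 | b1 <;> rcases Int.units_eq_one_or (h.right 2) with b2 | b2 <;>
    simp only [a0, a1, a2, b0, b1, b2, Units.val_one, Units.val_neg, mul_one, mul_neg, one_mul, neg_mul, neg_neg, δ_one,
      δ_neg_one] at * <;>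
    omega

/-- The invariant passes to inverses. [folklore] -/
theorem good_inv {g : P} (hg : g ∈ goodSet) : g⁻¹ ∈ goodSet := by
  obtain ⟨hg0, hg1, hg2, hg3⟩ := hg
  simp only [goodSet, Set.mem_setOf_eq, tr_inv, inv_right_eq, Pi.neg_apply, sgnAut_apply]
  refine ⟨?_, ?_, ?_, ?_⟩ <;>
    rcases Int.units_eq_one_or (g.right 0) with a0 | a0 <;> rcases Int.units_eq_one_or (g.right 1) with a1 | a1 <;>
    rcases Int.units_eq_one_or (g.right 2) with a2 | a2 <;>
    simp only [a0, a1, a2, Units.val_one, Units.val_neg, mul_one, mul_neg, neg_neg, δ_one, δ_neg_one] at * <;>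
    omega

/-- **Every element of `HW` satisfies the parity invariant.** [cite: ConwaySloane1999, Ch. 4 §6.1] -/
theorem good_of_mem {g : P} (hg : g ∈ Grp) : g ∈ goodSet := by
  induction hg using Subgroup.closure_induction with
  | mem s hs => exact good_gens hs
  | one => simp only [goodSet, Set.mem_setOf_eq]; decide
  | mul x y _ _ hx hy => exact good_mul hx hy
  | inv x _ hx => exact good_inv hx

/-- **The fibre over the base value**: an element of `HW` with `chart = 0` is a vertical translation `((0,0,2m), 1)`.
[cite: KozmaNitzan2024, §4 p. 15 (fibres of the coordinate map)] -/
theorem eq_vertical {g : P} (hg : g ∈ Grp) (h0 : chart g = 0) : ∃ m : ℤ, g = mk ![0, 0, 2 * m] 1 := by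
  obtain ⟨hp, d0, d1, d2⟩ := good_of_mem hg
  have c0 : tr g 0 = 0 := by simpa [chart] using congrFun h0 0
  have c1 : tr g 1 - δ (g.right 1) = 0 := by simpa [chart] using congrFun h0 1
  rcases Int.units_eq_one_or (g.right 0) with a0 | a0 <;> rcases Int.units_eq_one_or (g.right 1) with a1 | a1 <;>
    rcases Int.units_eq_one_or (g.right 2) with a2 | a2 <;>
    simp only [a0, a1, a2, Units.val_one, Units.val_neg, mul_one, mul_neg, neg_neg, δ_one, δ_neg_one] at hp d0 d1 d2 c1 <;>
    (try omega)
  -- the only consistent case: `D = 1`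
  obtain ⟨m, hm⟩ := d2
  refine ⟨m, ?_⟩
  rw [← mk_tr_right g]
  refine congrArg₂ mk ?_ ?_
  · funext i
    fin_cases i
    · simpa using c0
    · simpa using c1
    · simp only [Fin.reduceFinMk, Matrix.cons_val]; omega
  · funext i
    fin_cases i
    · simpa using a0
    · simpa using a1
    · simpa using a2

/-! ## §6 `Hom(HW, ℤ) = 0`: the first Betti number of the Hantzsche–Wendt group is zero -/

/-- `β a² β⁻¹ = a⁻²` in `HW`. [folklore] -/
theorem rel₁' : b * a * a * b⁻¹ = (a * a)⁻¹ := Subtype.ext rel₁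

/-- `α b² α⁻¹ = b⁻²` in `HW`. [folklore] -/
theorem rel₂' : a * b * b * a⁻¹ = (b * b)⁻¹ := Subtype.ext rel₂

/-- **`b₁(HW) = 0`: every homomorphism `HW → ℤ` is trivial** (`χ(α) = 0` from `βα²β⁻¹ = α⁻²`, `χ(β) = 0` from `αβ²α⁻¹ = β⁻²`).  So `HW`
has NO homomorphism to `ℤ²` of rank two: it lies outside the additive Cayley rows (`CayleySign₂`, `CayleyScaled`, `AutScaled`) of the class map.
[cite: BenjaminiSchramm1996, §2 (Cayley graphs)] -/
theorem hom_int_trivial (χ : Grp →* Multiplicative ℤ) : χ = 1 := by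
  have ha : χ a = 1 := by
    have h := congrArg (fun x => (χ x).toAdd) rel₁'
    simp only [map_mul, map_inv, toAdd_mul, toAdd_inv] at h
    have : (χ a).toAdd = 0 := by omega
    exact toAdd_eq_zero.1 this
  have hb : χ b = 1 := by
    have h := congrArg (fun x => (χ x).toAdd) rel₂'
    simp only [map_mul, map_inv, toAdd_mul, toAdd_inv] at h
    have : (χ b).toAdd = 0 := by omega
    exact toAdd_eq_zero.1 this
  ext g
  obtain ⟨x, hx⟩ := g
  induction hx using Subgroup.closure_induction with
  | mem s hs =>
    simp only [gens, Set.mem_insert_iff, Set.mem_singleton_iff] at hs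
    rcases hs with rfl | rfl | rfl | rfl
    · exact congrArg Multiplicative.toAdd ha
    · have e : (⟨α⁻¹, inv_mem α_mem⟩ : Grp) = a⁻¹ := rfl
      rw [e, map_inv, ha, inv_one]; rfl
    · exact congrArg Multiplicative.toAdd hb
    · have e : (⟨β⁻¹, inv_mem β_mem⟩ : Grp) = b⁻¹ := rfl
      rw [e, map_inv, hb, inv_one]; rfl
  | one => exact congrArg Multiplicative.toAdd (map_one χ)
  | mul x y hx hy ihx ihy =>
    have e : (⟨x * y, mul_mem hx hy⟩ : Grp) = ⟨x, hx⟩ * ⟨y, hy⟩ := rfl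
    rw [e, map_mul]
    show (χ ⟨x, hx⟩ * χ ⟨y, hy⟩).toAdd = (1 : Multiplicative ℤ).toAdd
    have hx' : χ ⟨x, hx⟩ = 1 := ihx
    have hy' : χ ⟨y, hy⟩ = 1 := ihy
    rw [hx', hy', one_mul]
  | inv x hx ih =>
    have e : (⟨x⁻¹, inv_mem hx⟩ : Grp) = ⟨x, hx⟩⁻¹ := rfl
    rw [e, map_inv]
    show (χ ⟨x, hx⟩)⁻¹.toAdd = (1 : Multiplicative ℤ).toAdd
    have hx' : χ ⟨x, hx⟩ = 1 := ih
    rw [hx', inv_one]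

end HW

end Summit.CriticalPhenomena.PercolationContinuityZ3.Theorems.Transplant

end
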